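import Summits.MatrixMultiplication.MatrixMultiplication.Theorems.SoloInformedLinesToBox
import Summits.MatrixMultiplication.MatrixMultiplication.Theorems.SoloInformedXPair
import Summits.MatrixMultiplication.MatrixMultiplication.Theorems.SoloInformedFamilyKinds

/-!
# THEOREM 8.20, Step 2 composed: an `𝓧`-typed pair ends the poor world numerically

This work, §8.8 (T13) and C3-m2 §5.3 Step 2, §5.6 (gen 108: the kernel glue). Setting as in
`SoloInformedBoxEnding` (every chart).

Input of Step 2: a reference row `j₁` of `b`, a partner `j` whose pair `(j, j₁)` is `𝓧`-typed by
`Data.pair_typed` (`a(·,j) ∼ w`, `a(·,j₁) ∼ w″` on all but `< t` rows, `w″ ≁ w`), and a family `P` of rows each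
having a common constancy cell of size `≥ s` (and `> t`) with `j₁`. Output (`Data.xpair_ending`): one of three
product bounds `n·t·s ≤ M`, `n·t·(n−t) ≤ M`, `n·t·(n−2t) ≤ M`, or `n³ ≤ 192·M` — the chain
`Data.xpair_data` (full `𝓧`-pair data) → `Data.family_kinds` (half of `P` of one kind, line data with `≤ 2t`
exceptions) → `Data.lines_ending` (discard heavy transversal lines, THEOREM 8.19 in every class configuration,
trichotomy arithmetic) with `c_L = 4`, `d = 2t`, budget `576·(6t+1) ≤ n`.
-/

namespace Summit.MatrixMultiplication.MatrixMultiplication.Theorems.TwistedTPP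

namespace FibreLines

variable {ι G : Type*} [AddCommGroup G]
variable {G₀ : Type*} [AddCommGroup G₀] {R : Type*}

/-- **THEOREM 8.20, Step 2 (numerical form, every chart).** [this work §8.8 (T13); C3-m2 §5.3, §5.6] -/
theorem Data.xpair_ending [Fintype ι] [DecidableEq ι] [Fintype G₀] [DecidableEq G₀] [Fintype R]
    [DecidableEq R] [DecidableEq G] (hG : ∀ x : G, x = -x → x = 0) (D : Data ι G) (Φ : Chart ι G₀)
    (κ : G → R) (hκ : ∀ x y, κ x = κ y → SignEq x y) (hsep : D.SepAll Φ) {j j₁ : ι} {w'' w : G}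
    (hX : ¬ SignEq w'' w) (Ig : Finset ι) (t : ℕ) (hIg : Fintype.card ι < Ig.card + t)
    (ha : ∀ i ∈ Ig, SignEq (D.a i j) w ∧ SignEq (D.a i j₁) w'') (P : Finset ι) (s : ℕ)
    (hP : ∀ j'' ∈ P, ∃ Ks : Finset ι, ∃ u'' u : G, s ≤ Ks.card ∧ t < Ks.card ∧
      (∀ k ∈ Ks, SignEq (D.b j'' k) u'') ∧ ∀ k ∈ Ks, SignEq (D.b j₁ k) u)
    (hPn : Fintype.card ι ≤ 2 * P.card) (hbudget : 576 * (6 * t + 1) ≤ Fintype.card ι) :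
    Fintype.card ι * t * s ≤ Fintype.card R * Fintype.card G₀ ∨
    Fintype.card ι * t * (Fintype.card ι - t) ≤ Fintype.card R * Fintype.card G₀ ∨
    Fintype.card ι * t * (Fintype.card ι - t - t) ≤ Fintype.card R * Fintype.card G₀ ∨
    Fintype.card ι ^ 3 ≤ 192 * (Fintype.card R * Fintype.card G₀) := by
  classical
  rcases D.xpair_data hG Φ κ hκ hsep hX Ig t t hIg ha with hb | ⟨E, F, hE, hF, haj, haj₁, -, hbj₁⟩
  · exact Or.inr (Or.inl hb)
  rcases D.family_kinds hG Φ κ hκ hsep (j₁ := j₁) (j₂ := j) (v := w) (v' := w'')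
      (fun h => hX h.symm) E F t t t s hE hF haj₁ haj hbj₁ P hP with hb | hb |
      ⟨K, -, hPK, Ea, Fb, hcard, hkinds⟩
  · exact Or.inl hb
  · exact Or.inr (Or.inr (Or.inl hb))
  right; right; right
  have hK : Fintype.card ι ≤ 4 * K.card := by omega
  have hbud : 144 * 4 * (3 * (2 * t) + 1) ≤ Fintype.card ι := by omega
  have h48 : 48 * 4 * (Fintype.card R * Fintype.card G₀) = 192 * (Fintype.card R * Fintype.card G₀) := by
    ring
  rcases hkinds with hk | hk
  · have h := D.lines_ending hG Φ κ hκ hsep K (2 * t) 4 Ea Fb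
      (fun j hj => ⟨by have := (hcard j hj).1; omega, (hk j hj).1⟩)
      (fun j hj => ⟨by have := (hcard j hj).2; omega, (hk j hj).2⟩) hK hbud
    exact h48 ▸ h
  · have h := D.lines_ending hG Φ κ hκ hsep K (2 * t) 4 Ea Fb
      (fun j hj => ⟨by have := (hcard j hj).1; omega, (hk j hj).1⟩)
      (fun j hj => ⟨by have := (hcard j hj).2; omega, (hk j hj).2⟩) hK hbud
    exact h48 ▸ h

end FibreLines

end Summit.MatrixMultiplication.MatrixMultiplication.Theorems.TwistedTPP
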